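import Literature.MathematicalPhysics.QuantumFieldTheory.Balaban1983to89.B9Eq326LocalPartBlockDecay
import Literature.MathematicalPhysics.QuantumFieldTheory.Balaban1983to89.B9Eq349BondBlockDecayFromCircle
import Literature.MathematicalPhysics.QuantumFieldTheory.Balaban1983to89.B9Eq349ConjugatedQTowerLettersCompanion

/-!
# `Balaban1983to89.B9Eq326LocalPartBlockDecayTowerClosed` — T. Bałaban, *Propagators for lattice gauge theories in a background field*, Commun. Math. Phys.
# **99** (1985) 389–434 [Balaban1985BackgroundPropagators] (3.26) p. 395 (the local part `A₀ = Δ(U) + D_UD*_U + Q*aQ`), (3.15)–(3.16) p. 393 (`Q_k(U)`), Thm 3.11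
# p. 416 *«… the kernels … decay exponentially»*, (3.49) p. 399, (3.69) p. 404, with [Balaban1985Variational] (134)–(136) p. 298: **THE `L²` BIG-BLOCK DECAY OF
# THE INVERSE OF THE TOWER LOCAL PART — `‖P_{y₁} ∘ A₀,k⁻¹ ∘ P_{y₀}‖ ≤ (4∕γ)·e^{r}·e^{−r·d_m(y₀,y₁)}` for `A₀,k = Δ(U) + D_UD*_U + Q_k(U)†(a•Q_k(U))` on the bonds of
# `T_{L^{n+1}m}` AT EVERY HEIGHT `n`, the conjugated `Q_k` ∕ `Δ′` letters DISCHARGED, in CLOSED radius windows** — the tower twin of the OWNER t4-ne9-p1's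
# one-step (D0dC) `B9Eq326LocalPartBlockDecayClosed`: the OWNER's GENERIC circle form `B9Eq326LocalPartBlockDecay.norm_conjLocalInv_le_of_circle` at
# `Pd := towerP L m (n+1)`, `Q := QkW`, the `hQK` binder by gen 94's `B9Eq349ConjugatedQTowerLettersCompanion.exists_expConj_Qk_letters` + `norm_expConj_curvOp_sub_le`,
# the block read-out by `B9Eq349BondBlockDecayFromCircle.norm_bondBlock_le_exp_of_uniform_circle_bound_cast` along `towerP_eq_fineP_pow`; the (D-E)₀,k binder
# `hdec` of ne9-leaf-03 g78's (EA0S) `B9Eq326LocalPartTowerSupDecay.norm_localInvK_apply_le_decay` (OFFER O-leaf03-g78-1 toward beta-an4's INTERFACE REQUEST D4)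

statement-level skeleton of published theorems with citation tags; proofs where landed; nothing here is a claim about the Yang–Mills mass gap

CITATION HEADER (lean-in-tree rule).  Audit cell `pub-balaban`, sub-cell `t4`, BINDER row NE9; filed by NE9 crux-team LEAF PROVER 03 (`b2b-balaban-t4-ne9-formalise-leaf-03`,
gen 78; road ΔA-CT).  Imports the OWNER's `B9Eq326LocalPartBlockDecay` (§1 `norm_conjLocalInv_le_of_circle`, generic in the lattice and in `Q`), this lineage's
`B9Eq349BondBlockDecayFromCircle` (`…_cast`), gen 94's `B9Eq349ConjugatedQTowerLettersCompanion` (`exists_expConj_Qk_letters`; through it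
`B9Eq349ConjugatedQLettersCompanion.norm_expConj_curvOp_sub_le`, `B9Eq369CurvFormL2.re_inner_curvOp_self_ge`, `B9Eq387IMSLocalLettersLattice.exists_pointwise_clm`).
Sources READ first-hand in the held text layer (`paper:balaban1985-cmp99-background-propagators` p. 393 (3.15)–(3.16)).  Print's decay proof is the random walk of
Sect. C; the cell's road is Combes–Thomas conjugation + the Cauchy kernel; NOTHING of print's proof is reproduced; [folklore] composition BY NAME.

WHAT IS PROVED (sorry-free; proof lane — 0 `def`; [folklore]).
* **`norm_block_localInvK_apply_le_closed`** — for `A₀ = hessOp + D_U∘D*_U + Q_k(U)†(a•Q_k(U))` on `BondL2K ℂ d (towerP L m (n+1)) c₀ W` (`hpos₀`), its `γ`-coercivity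
  (Thm 3.11 currency, displayed), the MODEL letters (`U(b) ∈ U1`, `hRS`, trace datum, plaquette smallness `δ`, the per-level letters of `Q_k`), the diagonal
  `ηL^{n+1} = 1`, and the CLOSED radius windows (`rℓη ≤ 1`, `4rℓM_φM_φ′d√d ≤ β`, `4rℓM_φM_φ′d ≤ β`, `2rℓM_φM_φ′√d ≤ β`, `r(3ℓ′ + L^{n+1}ℓη) ≤ 1`,
  `r·2dL^nℓη ≤ 1`, the tower `dQ` window `C_T(r) ≤ β` (gen 93's product difference, linearised height-free by ne9-leaf-03's (CRWT)), `8r(ℓη)·p_K ≤ β_K`,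
  `p_K∕2 + 3(2+a)β² + β_K ≤ γ∕4`): `‖P_{y₁} ∘ A₀⁻¹ ∘ P_{y₀}‖ ≤ (4∕γ)·e^{r}·e^{−r·d_m(y₀,y₁)}` for the big-block bond family `P` and every pair of unit-lattice sites.
HONEST SCOPE.  Composition BY NAME; `γ` and `hpos₀` displayed (for the local part `A₀,k ≥ Δ_{a,k}`, `B9Eq326WoodburySchur` §5, so the OWNER's
`exists_coercive_laplaceAk_diagonal_closed` supplies them — the closing is the next files (EA0TC)∕(FCL0)); the `dQ` window is height-dependent as displayed and reads
height-free through (CRWT) `tower_dQ_diff_le_linear`; nothing of [B9] Thm 3.1∕3.3∕3.11 asserted, valued or discharged; «NE9 ⇐ the named binders»; NE9 NOT PRINTED ∕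
NOT PROVED; row WALLED ON A MODEL (O-NE9-1; #5 UNRULED); spine PROVED 0∕9; rung (B)+1 on a finite T⁴ — NOT infinite volume, NOT mass gap, NOT BetaPertH, NOT Clay.
HONEST DEPENDENCY: continuum YM on T⁴ ⇐ BetaPertH ∧ nine spine estimates (0/9 proved); BetaPertH ⇐ (D1) ∧ (D4) ∧ CAP+tail; G-an2-4 gates asym, D1 and NE2/3/4.
NEW file; nothing modified.  Net new unproved facts: 0.
-/

noncomputable section

open scoped InnerProductSpace ComplexConjugate BigOperators
open NormedSpace

namespace Literature.MathematicalPhysics.QuantumFieldTheory.Balaban1983to89.B9Eq326LocalPartBlockDecayTowerClosed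

open B4Sect5Torus (TSite tdist)
open B9SectCLatticeCarrier (Bond DirPair bpos btgt)
open B9Eq311L2Pairing (WL2)
open B9Eq319QprimeTorus (fineP blockCoord)
open B7Prop1Explicit (U1 Wcx boxVec)
open B11Eq103H1Complex (SiteL2K BondL2K greenK covDerivL2K covDivL2K)
open B9Eq310DeltaPrime (reHol imHol)
open B9Eq310HessianOperator (adTransportW PlaqL2K curvOp hessOp)
open B9Eq315QTorus (perCfg cornerSite)
open B9Eq315QTower (towerP UlevOf)
open B9Eq316TowerFlatIsOneStep (siteCast towerP_eq_fineP_pow)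
open B9Eq326OperatorTower (QkW)
open B9Eq326LocalPartBlockDecay (norm_conjLocalInv_le_of_circle)
open B9Eq349BondBlockDecayFromCircle (norm_bondBlock_le_exp_of_uniform_circle_bound_cast)
open B9Eq349ConjugatedQTowerLettersCompanion (exists_expConj_Qk_letters)
open B9Eq349ConjugatedQLettersCompanion (norm_expConj_curvOp_sub_le)
open B9Eq369CurvFormL2 (re_inner_curvOp_self_ge)
open B9Eq387IMSLocalLettersLattice (exists_pointwise_clm)

variable {d : ℕ} (L : ℕ) [NeZero L] (m : Fin d → ℕ) [∀ i, NeZero (m i)] (n : ℕ)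
  {𝔸 : Type*} [NormedRing 𝔸] [StarRing 𝔸] [NormedAlgebra ℂ 𝔸] [StarModule ℂ 𝔸] [CompleteSpace 𝔸] [NormOneClass 𝔸]
  {W : Type*} [NormedAddCommGroup W] [InnerProductSpace ℂ W] [FiniteDimensional ℂ W] (φ : W ≃ₗ[ℂ] 𝔸) {Mφ Mφ' : ℝ}
  (hφ : ∀ w, ‖φ w‖ ≤ Mφ * ‖w‖) (hφ' : ∀ X, ‖φ.symm X‖ ≤ Mφ' * ‖X‖) (hMφ : 0 ≤ Mφ) (hMφ' : 0 ≤ Mφ') (hstar : ∀ X : 𝔸, ‖star X‖ ≤ ‖X‖)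
  {c₀ : ℝ} [Fact (0 < c₀)] {c₁ : ℝ} [Fact (0 < c₁)] {η : ℝ} (hη : 0 < η) (hηL : η * (L : ℝ) ^ (n + 1) = 1)
  (U : Bond d (towerP L m (n + 1)) → 𝔸ˣ) (hU : ∀ b, U b ∈ U1 𝔸)
  (hRS : ∀ (b : Bond d (towerP L m (n + 1))) (v u : W), ⟪adTransportW φ U b v, u⟫_ℂ = ⟪v, adTransportW φ (fun b => (U b)⁻¹) b u⟫_ℂ)
  (τ : 𝔸 →ₗ[ℂ] ℂ) {Mτ : ℝ} (hτ : ∀ X Y : 𝔸, ‖τ (X * Y)‖ ≤ Mτ * ‖X‖ * ‖Y‖) (hMτ : 0 ≤ Mτ)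
  (hL : 1 ≤ L) (hm : ∀ i, 1 ≤ m i) (α : ℕ → ℝ) (hα1 : ∀ j, α j ≤ 1 / 64)
  (hU1 : ∀ (j : ℕ) (x : B7Prop1Explicit.Site d) (k : Fin d), perCfg (towerP L m (j + 1)) (UlevOf L m (n + 1) U j) x k ∈ U1 𝔸)
  (hreg : ∀ (j : ℕ) (y : TSite d (towerP L m j)) (k : Fin d) (ρ' : Fin d → Fin L),
    ‖((Wcx L (perCfg (towerP L m (j + 1)) (UlevOf L m (n + 1) U j)) (cornerSite L y) k (boxVec L ρ') : 𝔸ˣ) : 𝔸) - 1‖ ≤ α j)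
  (εU : ℕ → ℝ) (hεU : ∀ j, 0 ≤ εU j)
  (hUε : ∀ (j : ℕ) (b : Bond d (towerP L m (j + 1))), ‖(UlevOf L m (n + 1) U j b : 𝔸) - 1‖ ≤ εU j)
  {δ : ℝ} (hδ : 0 ≤ δ)
  (hRe : ∀ p : B9SectCLatticeCarrier.Plaq d (towerP L m (n + 1)), ‖reHol U p - 1‖ ≤ δ)
  (hIm : ∀ p : B9SectCLatticeCarrier.Plaq d (towerP L m (n + 1)), ‖imHol U p‖ ≤ δ)
  -- the radius and the CLOSED windows
  {r ℓ ℓ' β βK : ℝ} (hr : 0 ≤ r) (hℓ : 1 ≤ ℓ) (hℓ' : 1 ≤ ℓ') (hβ : 0 ≤ β)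
  (hwin : r * ℓ * η ≤ 1) (hwin0 : r * (3 * ℓ' + (L : ℝ) ^ (n + 1) * (ℓ * η)) ≤ 1) (hwin1 : r * (2 * d * (L : ℝ) ^ n * (ℓ * η)) ≤ 1)
  (hβCC : 4 * r * ℓ * (Mφ * Mφ') * (d * Real.sqrt d) ≤ β) (hβC : 4 * r * ℓ * (Mφ * Mφ') * d ≤ β) (hβD : 2 * r * ℓ * (Mφ * Mφ') * Real.sqrt d ≤ β)
  (hβT : Mφ' * Mφ * Real.sqrt (c₁ / (c₀ * ((L : ℝ) ^ (n + 1)) ^ d)) *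
    ((∏ j ∈ Finset.range (n + 1), (1 + Real.sqrt ((L : ℝ) ^ d) * (Real.sqrt (2 * d) * (102 * (d + 1) ^ 2 * L * εU j) +
        2 * (r * (if j = 0 then 3 * ℓ' + (L : ℝ) ^ (n + 1) * (ℓ * η) else 2 * d * (L : ℝ) ^ (n + 1 - j) * (ℓ * η))) *
          Real.sqrt (2 * (2 * d * (102 * (d + 1) ^ 2 * L * εU j) ^ 2 + ((L : ℝ) ^ d)⁻¹))))) -
      ∏ j ∈ Finset.range (n + 1), (1 + Real.sqrt ((L : ℝ) ^ d) * (Real.sqrt (2 * d) * (102 * (d + 1) ^ 2 * L * εU j)))) ≤ β)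
  (hβK : 8 * (r * (ℓ * η)) * (768 * Fintype.card (DirPair d) * Mτ * Mφ ^ 2 * (‖((η : ℂ)) ^ d‖ / c₀) * ‖((η : ℂ))⁻¹‖ ^ 2 * δ) ≤ βK)

include hφ hφ' hMφ hMφ' hstar hη hηL hU hRS hτ hMτ hm hεU hUε hδ hRe hIm hr hℓ hℓ' hβ hwin hwin0 hwin1 hβCC hβC hβD hβT hβK in
/-- **THE `L²` BIG-BLOCK DECAY OF `A₀,k⁻¹`, CLOSED FORM, EVERY HEIGHT.**  For the tower local part `A₀ = Δ(U) + D_UD*_U + Q_k(U)†(a•Q_k(U))` (`0 ≤ a`, positive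
`hpos₀`, `γ`-coercive) on the bonds of `T_{L^{n+1}m}` at the diagonal `ηL^{n+1} = 1`, in the CLOSED windows of the variable block and
`p_K∕2 + 3(2+a)β² + β_K ≤ γ∕4`: `‖P_{y₁} ∘ A₀⁻¹ ∘ P_{y₀}‖ ≤ (4∕γ)·e^{r}·e^{−r·d_m(y₀,y₁)}` — the OWNER's generic circle form with `hQK` inhabited by gen 94's tower `Q_k`
letters and the `Δ′` letter, read out on the big blocks along the cast. [cite: Balaban1985BackgroundPropagators, (3.26) p.395, (3.15)–(3.16) p.393, Thm 3.11 p.416, (3.49)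
p.399, (3.69) p.404; Balaban1985Variational, (134)–(136) p.298] -/
theorem norm_block_localInvK_le_closed (a : ℝ) (ha : 0 ≤ a)
    (A₀ : BondL2K ℂ d (towerP L m (n + 1)) c₀ W →ₗ[ℂ] BondL2K ℂ d (towerP L m (n + 1)) c₀ W)
    (hA₀ : A₀ = hessOp φ η U τ + covDerivL2K ℂ c₀ ((η : ℂ))⁻¹ (adTransportW φ U) ∘ₗ covDivL2K ℂ c₀ ((η : ℂ))⁻¹ (adTransportW φ fun b => (U b)⁻¹) +
      LinearMap.adjoint (QkW L m n φ U hL α hα1 hU1 hreg (c₀ := c₀) (c₁ := c₁)) ∘ₗ ((a : ℂ) • QkW L m n φ U hL α hα1 hU1 hreg (c₀ := c₀) (c₁ := c₁)))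
    (hpos₀ : ∀ x : BondL2K ℂ d (towerP L m (n + 1)) c₀ W, x ≠ 0 → 0 < RCLike.re ⟪x, A₀ x⟫_ℂ)
    {γ : ℝ} (hγ : 0 < γ) (hcoer : ∀ f : BondL2K ℂ d (towerP L m (n + 1)) c₀ W, γ * ‖f‖ ^ 2 ≤ RCLike.re ⟪f, A₀ f⟫_ℂ)
    (small : (768 * Fintype.card (DirPair d) * Mτ * Mφ ^ 2 * (‖((η : ℂ)) ^ d‖ / c₀) * ‖((η : ℂ))⁻¹‖ ^ 2 * δ) / 2 + 3 * (2 + a) * β ^ 2 + βK ≤ γ / 4)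
    (PB : TSite d m → BondL2K ℂ d (towerP L m (n + 1)) c₀ W →L[ℂ] BondL2K ℂ d (towerP L m (n + 1)) c₀ W)
    (hPB : ∀ (y : TSite d m) (f : BondL2K ℂ d (towerP L m (n + 1)) c₀ W) (b : Bond d (towerP L m (n + 1))),
      WL2.equiv ℂ (fun _ : Bond d (towerP L m (n + 1)) => c₀) W (PB y f) b =
        if blockCoord (L ^ (n + 1)) m (siteCast (towerP_eq_fineP_pow L m (n + 1)) (bpos b)) = y then
          WL2.equiv ℂ (fun _ : Bond d (towerP L m (n + 1)) => c₀) W f b else 0)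
    (y₀ y₁ : TSite d m) :
    ‖PB y₁ ∘L LinearMap.toContinuousLinearMap (greenK A₀ hpos₀) ∘L PB y₀‖ ≤ 4 / γ * Real.exp r * Real.exp (-(r * tdist m y₀ y₁)) := by
  have hL0 : (0 : ℝ) < L := by exact_mod_cast Nat.pos_of_ne_zero (NeZero.ne L)
  have hLp : (0 : ℝ) < (L : ℝ) ^ (n + 1) := pow_pos hL0 _
  have hℓ0 : 0 ≤ ℓ := zero_le_one.trans hℓ
  have hℓ'0 : 0 ≤ ℓ' := zero_le_one.trans hℓ'
  have hι0 : 0 ≤ ℓ * η := mul_nonneg hℓ0 hη.le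
  have hι : 1 / ((L ^ (n + 1) : ℕ) : ℝ) ≤ ℓ * η := by
    rw [Nat.cast_pow, div_le_iff₀ hLp]
    calc (1 : ℝ) = 1 * (η * (L : ℝ) ^ (n + 1)) := by rw [hηL, mul_one]
      _ ≤ ℓ * (η * (L : ℝ) ^ (n + 1)) := by gcongr
      _ = ℓ * η * (L : ℝ) ^ (n + 1) := by ring
  -- the `p_K` floor of `Δ′` on the finest lattice
  set pK : ℝ := 768 * Fintype.card (DirPair d) * Mτ * Mφ ^ 2 * (‖((η : ℂ)) ^ d‖ / c₀) * ‖((η : ℂ))⁻¹‖ ^ 2 * δ with hpK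
  have hKre : ∀ f : BondL2K ℂ d (towerP L m (n + 1)) c₀ W, -(pK * ‖f‖ ^ 2) ≤ RCLike.re ⟪f, curvOp φ τ η U f⟫_ℂ :=
    fun f => re_inner_curvOp_self_ge φ hφ hstar τ hτ hMτ η U (fun b => B7Prop1Explicit.mem_U1.mp (hU b)) hδ hRe hIm f
  refine norm_bondBlock_le_exp_of_uniform_circle_bound_cast m (towerP_eq_fineP_pow L m (n + 1)) hm _ hPB hr (by positivity) hι hℓ'
    (fun χ χ' hχ hχ' MB hMB κ hκr => ?_) y₀ y₁
  -- the plaquette, site and coarse-bond multipliers of this weight pair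
  obtain ⟨MP, hMP⟩ := exists_pointwise_clm (𝕜 := ℂ) (w := fun _ : B9SectCLatticeCarrier.Plaq d (towerP L m (n + 1)) => c₀) (V := W)
    (fun p : B9SectCLatticeCarrier.Plaq d (towerP L m (n + 1)) => p.1) χ
  obtain ⟨MS, hMS⟩ := exists_pointwise_clm (𝕜 := ℂ) (w := fun _ : TSite d (towerP L m (n + 1)) => c₀) (V := W)
    (fun x : TSite d (towerP L m (n + 1)) => x) χ
  obtain ⟨MF, hMF⟩ := exists_pointwise_clm (𝕜 := ℂ) (w := fun _ : Bond d m => c₁) (V := W) (fun c : Bond d m => bpos c) χ'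
  refine norm_conjLocalInv_le_of_circle φ hφ hφ' hMφ hMφ' hη U hU hRS τ _ a hMB hMP hMS ha A₀ hA₀ hpos₀ hγ hβ hℓ0 hcoer hKre hχ hwin hβCC hβC hβD
    (fun κ' hκ'r => ⟨?_, fun f => ?_⟩) (βK := βK) small κ hκr
  · -- the `Q_k(U)` letters at `κ'` (gen 94's tower companion)
    have hw0 : ‖κ'‖ * (3 * ℓ' + (L : ℝ) ^ (n + 1) * (ℓ * η)) ≤ 1 := by rw [hκ'r]; exact hwin0
    have hw1 : ‖κ'‖ * (2 * d * (L : ℝ) ^ n * (ℓ * η)) ≤ 1 := by rw [hκ'r]; exact hwin1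
    obtain ⟨Qk, Qk', h1, h2, h3⟩ := exists_expConj_Qk_letters L m n hL hm φ hMφ hMφ' hφ hφ' (c₀ := c₀) (c₁ := c₁) U α hα1 hU1 hreg εU hεU hUε hι0 hℓ'0
      hχ hχ' hMB hMF hw0 hw1 a
    refine ⟨Qk, Qk', h1, fun f => (h2 f).trans ?_, fun g => (h3 g).trans ?_⟩
    · rw [hκ'r]; exact mul_le_mul_of_nonneg_right hβT (norm_nonneg _)
    · rw [hκ'r]; exact mul_le_mul_of_nonneg_right hβT (norm_nonneg _)
  · -- the `Δ′(U)` letter at `κ'`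
    have hwinK : ‖κ'‖ * (ℓ * η) ≤ 1 := by rw [hκ'r, ← mul_assoc]; exact hwin
    have h := norm_expConj_curvOp_sub_le φ hφ hMφ hstar τ hτ hMτ η U hU hδ hRe hIm hι0 hχ hMB hwinK f
    rw [hκ'r] at h
    exact h.trans (mul_le_mul_of_nonneg_right hβK (norm_nonneg _))

end Literature.MathematicalPhysics.QuantumFieldTheory.Balaban1983to89.B9Eq326LocalPartBlockDecayTowerClosed

end
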